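import Summits.FinalStateConjecture.FinalStateConjecture.Theses.SwallowTheDatum
import Summits.FinalStateConjecture.FinalStateConjecture.Theorems.SwallowTheDatumKerrShieldedSettlesStubCollarEmbedsMGHDAux
import Summits.FinalStateConjecture.FinalStateConjecture.Theorems.SwallowTheDatumSubdataDevelopmentsEmbedRigidity
import Literature.Geometry.Lorentzian.CauchyDevelopmentRestrict
import Literature.Geometry.Lorentzian.DataEmbeddingNormalSmooth
import HarnessLib

/-!
# `KerrShieldedSettles`, line `tapered-temporal-collar` — stub S3 `stub_collarEmbedsMGHD`, part 2 (the stub)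

Crux `stmt-FinalStateConjecture-10054`
(`Summit.FinalStateConjecture.FinalStateConjecture.Theses.SwallowTheDatum.KerrShieldedSettles`), registered stub
`stub_collarEmbedsMGHD`: **the tapered collar `W = {0 < x⁰ − T(r x) + (r x − r₁)/4}` of the ingoing
Kerr–Schild chart is a vacuum Cauchy development of the pulled-back data `D.comap φ` and embeds into every
maximal vacuum Cauchy development `𝒟` of `D`**, with the embedding `χ` unfolded at chart level (smooth and an
open embedding on `W`, `χ^*g_𝒟 = g_{M,a}`, `dχ(V)` future, `χ ∘ ψ = ι_𝒟 ∘ φ`, `dχ ν = ν_𝒟 ∘ φ`).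

Hypotheses taken by name / verbatim: the route item `SubdataDevelopmentsEmbed` (stmt-FinalStateConjecture-10053:
every vacuum Cauchy development of `D.comap Φ` embeds into a maximal development of `D` over `Φ`), the collar
Cauchy clause (= stub S1 `stub_collarCauchy`) and `Kerr.isRicciFlat M a r₁` (= stub S2 `stub_kerrVacuum`).

Proof (plumbing).  Pin `ψ = graph M a r₁` (`psi_eq_graph`); `dφ` is injective (part 1); the shield is a
`DataEmbedding` of `D.comap φ` into `Kerr.spacetime M a r₁ hM` (smooth embedding: part 1; `ι^*g = h`, `K_ν = k`
are the two pull-back identities); its normal is smooth along `ψ` (`DataEmbedding.mdifferentiableAt_embed_normal`);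
`DataEmbedding.restrict` to the open connected collar `W ⊇ ψ(slice)` (part 1), Cauchy by S1 (part 1,
`isCauchyHypersurface_collar`), vacuum by S2 (`isRicciFlat_restrict`; the `C^∞` and `C^ω` Kerr metrics have the
same values, hence the same Ricci tensor); `SubdataDevelopmentsEmbed` embeds this `VacuumCauchyDevelopment`;
extend off `W` by a junk value and unfold (`T_p W = T_p(region) = E4`, `mfderiv_comp_subtypeVal`,
`SubdataDevelopmentsEmbed.mfderiv_normal_rel`).

References: Sbierski, Ann. Henri Poincaré 17 (2016), Def. 2.4, §3.1; Ringström 2009, Def. 16.5;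
Choquet-Bruhat–Geroch 1969, p. 332.
-/

set_option linter.dupNamespace false

noncomputable section

open Set Filter Function
open scoped Manifold ContDiff Topology
open Literature.Geometry.Lorentzian
open Summit.FinalStateConjecture.FinalStateConjecture.Theses.SwallowTheDatum (SubdataDevelopmentsEmbed)
open Summit.FinalStateConjecture.FinalStateConjecture.Theorems.KerrShieldedDataExist.Negative
  (bentHeight graph psi_eq_graph mass_pos)

namespace Summit.FinalStateConjecture.FinalStateConjecture.Theorems.SwallowTheDatum.KerrShieldedSettles

open CollarEmbedsMGHD in
set_option linter.unusedVariables false in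
/-- **S3 `stub_collarEmbedsMGHD` — the tapered collar is a vacuum Cauchy development of the pulled-back
data and embeds into every maximal development** (line `tapered-temporal-collar` of crux
`stmt-FinalStateConjecture-10054`).  Given the shield (sub-extremal `(M,a)`, window `r₋ < r₁ < r₊`,
`φ : Kerr.slice a r₁ → X` a smooth open embedding, `ψ` the graph of `T = bentHeight M a` over the slice,
spacelike, future unit normal `ν`, `φ^*h = ψ^*g_{M,a}` and `φ^*k = K_ν(ψ)` pointwise), the collar Cauchy
property (stub S1, hypothesis), `Ric(g_{M,a}) = 0` on the chart (stub S2, hypothesis) and the route item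
`SubdataDevelopmentsEmbed` (10053, by name): for every MAXIMAL vacuum Cauchy development `𝒟` of `D` there
is a chart map `χ : Kerr.region a r₁ → 𝒟` which on `W = {0 < x⁰ − T(r x) + (r x − r₁)/4}` is smooth, an
open embedding, isometric, time-orientation preserving, with `χ ∘ ψ = ι_𝒟 ∘ φ` and `dχ ν = ν_𝒟 ∘ φ`.
Proof (plumbing): `ψ = graph M a r₁` is a smooth embedding (`isSmoothEmbedding_graph`), so with `dφ`
injective (`injective_mfderiv_of_inner_eq`) the shield is a `DataEmbedding` of `D.comap φ` into
`Kerr.spacetime M a r₁ hM`; its normal is smooth along `ψ` (`DataEmbedding.mdifferentiableAt_embed_normal`);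
restricting to the open connected collar `W ⊇ ψ(slice)` (`DataEmbedding.restrict`,
`isCauchyHypersurface_collar`, `isRicciFlat_restrict`) gives a `VacuumCauchyDevelopment`, which
`SubdataDevelopmentsEmbed` embeds into `𝒟`; extend the embedding off `W` by a junk value and unfold
(`T_p W = T_p(region) = E4`, `mfderiv_comp_subtypeVal`; the normal relation is `mfderiv_normal_rel`).
[cite: Sbierski2016AHP, Def. 2.4] [cite: Ringstrom2009, Def. 16.5] -/
theorem stub_collarEmbedsMGHD : SubdataDevelopmentsEmbed → ∀ [Kerr.Facts] (X : Type) [TopologicalSpace X]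
    [ChartedSpace E3 X] [IsManifold (𝓡 3) ((⊤ : ℕ∞) : WithTop ℕ∞) X] [T2Space X]
    [SecondCountableTopology X] [ConnectedSpace X] (D : InitialDataSet (𝓡 3) X)
    (M a r₁ : ℝ) (hM : 0 ≤ M) (φ : Kerr.slice a r₁ → X)
    (ψ : Kerr.slice a r₁ → Kerr.region a r₁) (ν : NormalField 𝓘(ℝ, E4) ψ),
    |a| < M → Kerr.rMinus M a < r₁ → r₁ < Kerr.rPlus M a →
    Topology.IsOpenEmbedding φ → ContMDiff 𝓘(ℝ, E3) (𝓡 3) ((⊤ : ℕ∞) : WithTop ℕ∞) φ →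
    (∀ y : Kerr.slice a r₁, (ψ y : E4) =
        E4.ofTimeSpace (bentHeight M a (Kerr.radius a (E4.ofTimeSpace 0 (y : E3)))) (y : E3)) →
    (Kerr.smoothMetric M a r₁).IsSpacelikeImmersion 𝓘(ℝ, E3) ψ →
    (Kerr.smoothMetric M a r₁).IsFutureUnitNormal 𝓘(ℝ, E3)
        ((Kerr.timeOrientation M a r₁ hM).ofLE le_top) ψ ν →
    (∀ (y : Kerr.slice a r₁) (v w : E3),
        D.h.inner (φ y) (mfderiv 𝓘(ℝ, E3) (𝓡 3) φ y v) (mfderiv 𝓘(ℝ, E3) (𝓡 3) φ y w) =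
          Kerr.bilin M a (ψ y : E4) (mfderiv 𝓘(ℝ, E3) 𝓘(ℝ, E4) ψ y v)
            (mfderiv 𝓘(ℝ, E3) 𝓘(ℝ, E4) ψ y w)) →
    (∀ [(Kerr.smoothMetric M a r₁).HasLeviCivita] (y : Kerr.slice a r₁) (v w : E3),
        D.k (φ y) (mfderiv 𝓘(ℝ, E3) (𝓡 3) φ y v) (mfderiv 𝓘(ℝ, E3) (𝓡 3) φ y w) =
          (Kerr.smoothMetric M a r₁).secondFundamentalForm 𝓘(ℝ, E3) ψ ν y v w) →
    (∀ (γ : ℝ → Kerr.region a r₁) (s : Set ℝ), s.OrdConnected → s.Nonempty →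
      (Kerr.smoothMetric M a r₁).IsFutureTimelikeCurveOn
          ((Kerr.timeOrientation M a r₁ hM).ofLE le_top) γ s →
      (∀ t ∈ s, 0 < (γ t : E4) 0 - bentHeight M a (Kerr.radius a (γ t : E4)) +
          (Kerr.radius a (γ t : E4) - r₁) / 4) →
      (∀ q : Kerr.region a r₁, 0 < (q : E4) 0 - bentHeight M a (Kerr.radius a (q : E4)) +
          (Kerr.radius a (q : E4) - r₁) / 4 →
            ¬ HasFutureEndpoint γ s q ∧ ¬ HasPastEndpoint γ s q) →
      ∃! t, t ∈ s ∧ (γ t : E4) 0 = bentHeight M a (Kerr.radius a (γ t : E4))) →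
    Kerr.isRicciFlat M a r₁ →
    ∀ 𝒟 : VacuumCauchyDevelopment D, 𝒟.IsMaximal →
      ∃ χ : Kerr.region a r₁ → 𝒟.carrier,
        ContMDiffOn 𝓘(ℝ, E4) (𝓡 4) ((⊤ : ℕ∞) : WithTop ℕ∞) χ
          {x | 0 < (x : E4) 0 - bentHeight M a (Kerr.radius a (x : E4)) +
            (Kerr.radius a (x : E4) - r₁) / 4} ∧
        Topology.IsOpenEmbedding (Set.restrict {x : Kerr.region a r₁ |
          0 < (x : E4) 0 - bentHeight M a (Kerr.radius a (x : E4)) +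
            (Kerr.radius a (x : E4) - r₁) / 4} χ) ∧
        (∀ x : Kerr.region a r₁, 0 < (x : E4) 0 - bentHeight M a (Kerr.radius a (x : E4)) +
            (Kerr.radius a (x : E4) - r₁) / 4 →
          (∀ v w : E4, 𝒟.metric.val (χ x) (mfderiv 𝓘(ℝ, E4) (𝓡 4) χ x v)
              (mfderiv 𝓘(ℝ, E4) (𝓡 4) χ x w) = Kerr.bilin M a (x : E4) v w) ∧
          𝒟.metric.val (χ x) (𝒟.timeOrientation.vectorField (χ x))
              (mfderiv 𝓘(ℝ, E4) (𝓡 4) χ x (Kerr.timeVector M a (x : E4))) < 0) ∧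
        (∀ y : Kerr.slice a r₁, χ (ψ y) = 𝒟.embed (φ y)) ∧
        (∀ y : Kerr.slice a r₁, mfderiv 𝓘(ℝ, E4) (𝓡 4) χ (ψ y) (ν y) = 𝒟.normal (φ y)) := by
  intro hSub _ X _ _ _ _ _ _ D M a r₁ hM φ ψ ν ha hr₁ hr₂ hφo hφs hψ hsp hν hh hk hC hRic 𝒟 h𝒟
  -- the graph clause pins `ψ` to the explicit leaf
  obtain rfl : ψ = graph M a r₁ := psi_eq_graph rfl hψ
  have hM0 : 0 < M := mass_pos ha
  haveI : ConnectedSpace (Kerr.slice a r₁) :=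
    isConnected_iff_connectedSpace.mp (Kerr.isConnected_slice_holds a r₁)
  -- smoothness degree `∞ + 1 = ∞` and injectivity of `dφ`
  have hφ1 : ContMDiff (𝓡 3) (𝓡 3) (((⊤ : ℕ∞) : WithTop ℕ∞) + 1) φ := hφs
  have hφ' : ∀ u, Function.Injective (mfderiv (𝓡 3) (𝓡 3) φ u) :=
    injective_mfderiv_of_inner_eq D hsp hh
  have hφd : MDifferentiable (𝓡 3) (𝓡 3) φ := hφ1.mdifferentiable (by simp)
  -- the exact slice data and its data embedding into the whole chart
  let Dₑ : InitialDataSet (𝓡 3) (Kerr.slice a r₁) := D.comap φ hφ1 hφ'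
  let 𝒮K : DataEmbedding Dₑ :=
    { toSpacetime := Kerr.spacetime M a r₁ hM
      embed := graph M a r₁
      isSmoothEmbedding := isSmoothEmbedding_graph hM0 a r₁
      normal := ν
      isFutureUnitNormal := hν
      induced_h := fun y ↦ by
        ext v w
        exact (hh y v w).symm
      induced_k := by
        intro instLC y
        haveI : (Kerr.smoothMetric M a r₁).HasLeviCivita := instLC
        ext v w
        exact (hk y v w).symm }
  have hvac : 𝒮K.IsVacuum := by
    intro instLC x
    haveI : (Kerr.metric M a r₁).HasLeviCivita := instLC
    exact hRic x
  -- restriction to the collar: a vacuum Cauchy development of the exact slice data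
  have hW : IsConnected (collar M a r₁ hM0 : Set (Kerr.region a r₁)) := isConnected_collar hM0
  have hι : ∀ y, 𝒮K.embed y ∈ collar M a r₁ hM0 := graph_mem_collar hM0
  let 𝒲 : VacuumCauchyDevelopment Dₑ :=
    { toDataEmbedding := 𝒮K.restrict (collar M a r₁ hM0) hW hι 𝒮K.mdifferentiableAt_embed_normal
      isCauchyHypersurface := isCauchyHypersurface_collar hM hM0 hC
      isRicciFlat := by
        intro instLC
        haveI : (𝒮K.metric.restrict PseudoRiemannianMetric.contMDiff_restrict_holds
            (collar M a r₁ hM0)).toPseudoRiemannianMetric.HasLeviCivita := instLC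
        exact 𝒮K.isRicciFlat_restrict (collar M a r₁ hM0) hvac }
  -- item 10053: the collar development embeds into the maximal development over `φ`
  obtain ⟨χ₀, hχs, hχo, hχi, hχt, hχe⟩ := hSub X D 𝒟 h𝒟 (Kerr.slice a r₁) φ hφ1 hφ' hφo 𝒲
  -- extend `χ₀` off the collar by a junk value
  classical
  let χ : Kerr.region a r₁ → 𝒟.carrier := fun x ↦
    if hx : 0 < (x : E4) 0 - bentHeight M a (Kerr.radius a (x : E4)) + (Kerr.radius a (x : E4) - r₁) / 4
    then χ₀ ⟨x, hx⟩ else Classical.arbitrary _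
  have hχW : ∀ p : collar M a r₁ hM0, χ p = χ₀ p := fun p ↦ dif_pos p.2
  have hχW' : (fun p : collar M a r₁ hM0 ↦ χ p) = χ₀ := funext hχW
  -- smoothness on the collar (`W` is an open submanifold of the chart)
  have hχat : ∀ x : Kerr.region a r₁, x ∈ collar M a r₁ hM0 →
      ContMDiffAt 𝓘(ℝ, E4) (𝓡 4) ((⊤ : ℕ∞) : WithTop ℕ∞) χ x := fun x hx ↦ by
    have h : ContMDiffAt 𝓘(ℝ, E4) (𝓡 4) ((⊤ : ℕ∞) : WithTop ℕ∞)
        (fun p : collar M a r₁ hM0 ↦ χ p) ⟨x, hx⟩ := by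
      rw [hχW']; exact hχs ⟨x, hx⟩
    exact contMDiffAt_subtype_iff.1 h
  have hχd : ∀ x : Kerr.region a r₁, x ∈ collar M a r₁ hM0 →
      MDifferentiableAt 𝓘(ℝ, E4) (𝓡 4) χ x := fun x hx ↦ (hχat x hx).mdifferentiableAt (by simp)
  -- the differential on the collar (`T_p W = T_p(region) = E4`, `d(Subtype.val) = id`)
  have hdχ : ∀ p : collar M a r₁ hM0,
      mfderiv (𝓡 4) (𝓡 4) χ₀ p = mfderiv 𝓘(ℝ, E4) (𝓡 4) χ p.1 := fun p ↦ by
    rw [← hχW']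
    exact mfderiv_comp_subtypeVal (hχd p.1 p.2)
  refine ⟨χ, fun x hx ↦ (hχat x hx).contMDiffWithinAt, ?_, ?_, ?_, ?_⟩
  · -- open embedding on the collar
    have hres : Set.restrict {x : Kerr.region a r₁ | 0 < (x : E4) 0 - bentHeight M a (Kerr.radius a (x : E4)) +
        (Kerr.radius a (x : E4) - r₁) / 4} χ = χ₀ := funext hχW
    rw [hres]
    exact hχo
  · -- isometry and time orientation on the collar
    intro x hx
    have e1 : χ x = χ₀ ⟨x, hx⟩ := hχW ⟨x, hx⟩
    have e2 : mfderiv 𝓘(ℝ, E4) (𝓡 4) χ x = mfderiv (𝓡 4) (𝓡 4) χ₀ ⟨x, hx⟩ := (hdχ ⟨x, hx⟩).symm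
    refine ⟨fun v w ↦ ?_, ?_⟩
    · have h := congrArg (fun B ↦ B v w) (hχi.2 ⟨x, hx⟩)
      simp only [pullbackBilin_apply] at h
      rw [e1, e2]
      exact h
    · have h := (hχt ⟨x, hx⟩).2
      rw [e1, e2]
      exact h
  · -- `χ ∘ ψ = ι ∘ φ`
    intro y
    have h := congrFun hχe y
    simp only [Function.comp_apply] at h
    rw [← h]
    exact hχW ⟨graph M a r₁ y, hι y⟩
  · -- `dχ ν = ν_𝒟 ∘ φ`
    intro y
    have h := SubdataDevelopmentsEmbed.mfderiv_normal_rel 𝒲.toDataEmbedding 𝒟.toDataEmbedding hχi hχt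
      hφd hφ' hχe y
    rw [hdχ] at h
    exact h

end Summit.FinalStateConjecture.FinalStateConjecture.Theorems.SwallowTheDatum.KerrShieldedSettles

end
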